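import Summits.Ventures.PercRepro.RankLevelSetRuleQSliceMapsAll

/-!
# PercRepro — THE UP-HALL CONDITION OF C-044 AT THE TIGHT LAYER FOR EVERY SUBFAMILY OF MEMBERS OUTSIDE THE SLICES
`2 ≤ q − #P ≤ k − 3` (night-1, gen 19; dossier §30)

`hallUp_of_ruleQ` (night-1 g13) turns «every member receives `≥ Φ(p, q)` under Rule Q's equal split» into the UP-Hall condition
for every subfamily `𝒜` of members by one double count (the load of every `S ∈ Y` is exactly 1). The double count only ever
uses the receipts of the members OF `𝒜`; so the same argument gives the Hall condition for a subfamily `𝒜` as soon as the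
members of `𝒜` are paid (`hallUp_of_recv_on`), and with the complete slice map of the families `k ≤ 7`
(`rhat_ge_phiK_of_slice`, `rhatCell_of_le_four`):
* **`hallUp_of_recv_on`** — `(∀ Z ∈ 𝒜, Φ(p,q) ≤ recv(Z)) → Φ(p,q) · #𝒜 ≤ #N⁺(𝒜)` for every `𝒜 ⊆ 𝒵`;
* **`hallUp_of_slices`** — at the tight layer `#E = (q+k) + q` of every finite matroid, `2 ≤ k ≤ 7`: every subfamily `𝒜` of
  members of the cell `(q+k, q)` all of whose members have `q − #(flatPart Z) ∉ [2, k − 3]` (no condition when `k ≤ 4`) has at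
  least `Φ(q+k, q) · #𝒜` UP-neighbours in `Y` — the UP-Hall condition of C-044 restricted to the members Rule Q pays.
Axioms: standard.
-/

namespace PercRepro

open Set Matroid Finset

variable {α : Type} (M : Matroid α) [M.Finite]

/-- **Rule Q's double count on a subfamily**: if every member of `𝒜 ⊆ 𝒵` receives at least `Φ(p,q)` under the equal split,
then `𝒜` has at least `Φ(p,q)·#𝒜` UP-neighbours (the body of `hallUp_of_ruleQ`, which only uses the receipts on `𝒜`). -/
theorem hallUp_of_recv_on (p q : ℕ) (𝒜 : Set (Set α)) (h𝒜 : 𝒜 ⊆ cellMembers M p q)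
    (h : ∀ Z ∈ 𝒜, phiK p q ≤ ruleQRecv M p q Z) :
    phiK p q * (𝒜.ncard : ℚ) ≤ ((upNbhd M p q 𝒜).ncard : ℚ) := by
  classical
  have h𝒜fin : 𝒜.Finite := (cellMembers_finite M p q).subset h𝒜
  set 𝒜f : Finset (Set α) := h𝒜fin.toFinset with h𝒜f
  set Yf : Finset (Set α) := (cellY_finite M p q).toFinset with hYf
  have h𝒜card : (𝒜.ncard : ℚ) = (𝒜f.card : ℚ) := by
    rw [h𝒜f, ncard_eq_toFinset_card _ h𝒜fin]
  -- step 1: Φ·#𝒜 ≤ Σ_{Z ∈ 𝒜} recv(Z)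
  have h1 : phiK p q * (𝒜f.card : ℚ) ≤ ∑ Z ∈ 𝒜f, ruleQRecv M p q Z := by
    rw [mul_comm, ← nsmul_eq_mul, ← Finset.sum_const]
    refine Finset.sum_le_sum (fun Z hZ => ?_)
    rw [h𝒜f, h𝒜fin.mem_toFinset] at hZ
    exact h Z hZ
  -- step 2: exchange the sums
  have h2 : ∑ Z ∈ 𝒜f, ruleQRecv M p q Z =
      ∑ S ∈ Yf, ((𝒜f.filter (fun Z => Z ⊆ S)).card : ℚ) * (1 / (memCount M p q S : ℚ)) := by
    unfold ruleQRecv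
    rw [← hYf, Finset.sum_comm]
    refine Finset.sum_congr rfl (fun S _ => ?_)
    simp only [Set.indicator_apply, Set.mem_setOf_eq]
    rw [Finset.sum_ite, Finset.sum_const_zero, add_zero, Finset.sum_const, nsmul_eq_mul]
  -- step 3: each term is at most the indicator of «S contains a member of 𝒜»
  have h3 : ∀ S ∈ Yf, ((𝒜f.filter (fun Z => Z ⊆ S)).card : ℚ) * (1 / (memCount M p q S : ℚ)) ≤
      (if ∃ Z ∈ 𝒜, Z ⊆ S then (1 : ℚ) else 0) := by
    intro S _
    by_cases hex : ∃ Z ∈ 𝒜, Z ⊆ S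
    · rw [if_pos hex]
      have hle : (𝒜f.filter (fun Z => Z ⊆ S)).card ≤ memCount M p q S := by
        unfold memCount
        rw [← ncard_coe_finset]
        refine ncard_le_ncard ?_ ((cellMembers_finite M p q).subset (fun _ hZ => hZ.1))
        intro Z hZ
        rw [Finset.mem_coe, Finset.mem_filter, h𝒜f, h𝒜fin.mem_toFinset] at hZ
        exact ⟨h𝒜 hZ.1, hZ.2⟩
      have hpos : 0 < memCount M p q S := by
        obtain ⟨Z, hZ, hZS⟩ := hex
        have : (𝒜f.filter (fun Z => Z ⊆ S)).card ≠ 0 := by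
          rw [Finset.card_ne_zero]
          exact ⟨Z, Finset.mem_filter.2 ⟨by rw [h𝒜f, h𝒜fin.mem_toFinset]; exact hZ, hZS⟩⟩
        omega
      have hposq : (0 : ℚ) < (memCount M p q S : ℚ) := by exact_mod_cast hpos
      rw [mul_one_div, div_le_one hposq]
      exact_mod_cast hle
    · rw [if_neg hex]
      have hzero : (𝒜f.filter (fun Z => Z ⊆ S)).card = 0 := by
        rw [Finset.card_eq_zero, Finset.filter_eq_empty_iff]
        intro Z hZ hZS
        rw [h𝒜f, h𝒜fin.mem_toFinset] at hZ
        exact hex ⟨Z, hZ, hZS⟩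
      rw [hzero]
      simp
  -- step 4: the indicators sum to the size of the UP-neighbourhood
  have h4 : ∑ S ∈ Yf, (if ∃ Z ∈ 𝒜, Z ⊆ S then (1 : ℚ) else 0) = ((upNbhd M p q 𝒜).ncard : ℚ) := by
    rw [Finset.sum_ite, Finset.sum_const_zero, add_zero, Finset.sum_const, nsmul_eq_mul, mul_one]
    have hU : upNbhd M p q 𝒜 = ((Yf.filter (fun S => ∃ Z ∈ 𝒜, Z ⊆ S) : Finset (Set α)) : Set (Set α)) := by
      ext S
      rw [Finset.coe_filter, hYf, Set.mem_setOf_eq, (cellY_finite M p q).mem_toFinset]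
      constructor
      · intro hS
        exact ⟨⟨hS.1, hS.2.1, hS.2.2.1⟩, hS.2.2.2⟩
      · intro hS
        exact ⟨hS.1.1, hS.1.2.1, hS.1.2.2, hS.2⟩
    rw [hU, ncard_coe_finset]
  calc phiK p q * (𝒜.ncard : ℚ) = phiK p q * (𝒜f.card : ℚ) := by rw [h𝒜card]
    _ ≤ ∑ Z ∈ 𝒜f, ruleQRecv M p q Z := h1
    _ = ∑ S ∈ Yf, ((𝒜f.filter (fun Z => Z ⊆ S)).card : ℚ) * (1 / (memCount M p q S : ℚ)) := h2
    _ ≤ ∑ S ∈ Yf, (if ∃ Z ∈ 𝒜, Z ⊆ S then (1 : ℚ) else 0) := Finset.sum_le_sum h3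
    _ = ((upNbhd M p q 𝒜).ncard : ℚ) := h4

/-- **Every member outside the slices `2 ≤ q − #P ≤ k − 3` is paid, `2 ≤ k ≤ 7`** (no condition on `k ≤ 4`). -/
theorem ruleQRecv_ge_phiK_of_slice_le_seven {q k : ℕ} (hk2 : 2 ≤ k) (hk7 : k ≤ 7) (hE : M.E.ncard = (q + k) + q)
    {Z : Set α} (hZ : Z ∈ cellMembers M (q + k) q)
    (hu : k ≤ 4 ∨ q < (flatPart M Z).ncard + 2 ∨ (flatPart M Z).ncard + (k - 2) ≤ q) :
    phiK (q + k) q ≤ ruleQRecv M (q + k) q Z := by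
  have hm := ncard_flatPart_le M hE hZ
  have h2 := rhat_le_ruleQRecv M hE hZ
  refine le_trans ?_ h2
  rcases Nat.lt_or_ge k 5 with hlt | hge
  · have h := rhat_slice_of_le_four k (q - (flatPart M Z).ncard) hk2 (by omega) q (Nat.sub_le _ _)
    rwa [Nat.sub_sub_self hm] at h
  · exact rhat_ge_phiK_of_slice k q _ hge hk7 hm (by omega)

/-- **THE UP-HALL CONDITION OF C-044 AT THE TIGHT LAYER, ON THE MEMBERS RULE Q PAYS**: at `#E = (q+k) + q`, `2 ≤ k ≤ 7`, every
subfamily `𝒜` of members of the cell `(q+k, q)` whose members all have `q − #(flatPart Z) ∉ [2, k − 3]` (every subfamily when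
`k ≤ 4`) has at least `Φ(q+k, q) · #𝒜` UP-neighbours in `Y`. -/
theorem hallUp_of_slices {q k : ℕ} (hk2 : 2 ≤ k) (hk7 : k ≤ 7) (hE : M.E.ncard = (q + k) + q)
    (𝒜 : Set (Set α)) (h𝒜 : 𝒜 ⊆ cellMembers M (q + k) q)
    (hP : ∀ Z ∈ 𝒜, k ≤ 4 ∨ q < (flatPart M Z).ncard + 2 ∨ (flatPart M Z).ncard + (k - 2) ≤ q) :
    phiK (q + k) q * (𝒜.ncard : ℚ) ≤ ((upNbhd M (q + k) q 𝒜).ncard : ℚ) :=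
  hallUp_of_recv_on M (q + k) q 𝒜 h𝒜 (fun Z hZ => ruleQRecv_ge_phiK_of_slice_le_seven M hk2 hk7 hE (h𝒜 hZ) (hP Z hZ))

end PercRepro
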